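import Mathlib
import Literature.Combinatorics.Optimization.UdisjShiftNonnegativeRank
import HarnessLib

/-!
# Braun–Fiorini–Pokutta–Steurer 2012, §4.2: polyhedral inapproximability of CLIQUE (Lemma 7, Theorem 8) — PROVED

G. Braun, S. Fiorini, S. Pokutta, D. Steurer, *Approximation Limits of Linear Programs (Beyond Hierarchies)*,
FOCS 2012 = arXiv:1204.0957 [BraunEtAl2012] (journal: Math. Oper. Res. 40 (2015) [BraunEtAl2015]), §4.2
(pp. 13–14, materialised `paper:arxiv-1204.0957` p0013–p0014).

§4.2 encodes CLIQUE linearly in dimension `n²` (p. 13): feasible solutions `x = bbᵀ`, `b ∈ {0,1}ⁿ` (so the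
inner polytope is `P = COR(n)`); for a graph `G` with `V(G) ⊆ [n]` the admissible objective `w^G` has
`w_ii = 1` (`i ∈ V(G)`), `w_ii = 0` (`i ∉ V(G)`), `w_ij = w_ji = −1` for non-edges `ij` of `G` inside `V(G)`,
`0` otherwise; `max ⟨w^G, bbᵀ⟩ = ω(G)`.  The outer convex set of the encoding is
`Q^all = {x ∈ ℝ^{n×n} ∣ ⟨w^G, x⟩ ≤ ω(G) for all graphs G with V(G) ⊆ [n], x_ij ≥ 0 for i ≠ j}`.

* `cliqueObjective V G` — `w^G` for the graph `G` restricted to the vertex set `V ⊆ [n]`;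
  `cliqueNumOn V G` — `ω(G[V])`; `cliqueOuterAll n` — `Q^all`.
* `BFPS2012_lemma7` — **Lemma 7**: `Q^all ⊆ Q(n)` («We show this by restricting to graphs `G` with
  `ω(G) = 1` … let `G` be the graph with `χ^{V(G)} = a` and `E(G) = ∅`. Then `⟨2diag(a) − aaᵀ, x⟩ =
  ⟨w^G, x⟩ ≤ ω(G) = 1`», p. 14), with `Q(n) = corOuter n 1` of `CorPolytopeApproximateEFLowerBound.lean`.
* `BFPS2012_thm8` — **Theorem 8, second sentence** («every `n^{1/2−ε}`-approximate EF of CLIQUE has size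
  `2^{Ω(n^{2ε})}`, for all `0 < ε < 1/2`», p. 14): every `K` with `COR(n) ⊆ K ⊆ n^{1/2−ε}·Q^all` admitting a
  size-`r` extended formulation (tree currency `HasEFOfSize K r`) has `2^{c n^{2ε}} ≤ r` for `n ≥ n₀`; PROVED
  from the tree's Theorem 6 `BFPS2012_corSandwichHard_holds` with `β = 1/2 − ε`, `ρ = n^β`, exactly as printed
  («Because `Q^all` is contained in the polyhedron `Q` … every `K` satisfying `P ⊆ K ⊆ ρQ^all` also satisfies
  `P ⊆ K ⊆ ρQ`. Hence, Theorem 6 yields …»).  The first sentence of Theorem 8 (an `O(n²)`-size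
  `n`-approximate EF exists) is an upper bound and is NOT typed here.

0 named facts; everything PROVED.  Nothing here is a summit statement; no P-vs-NP / VP-vs-VNP content.
-/

noncomputable section

open Matrix Finset
open scoped Pointwise

namespace Literature.Combinatorics.Optimization

open FixedSizePsdRank (Cube bvec vecOuter flat corPolytope)
open Literature.Barriers.PneNP (HasEFOfSize)

variable {n : ℕ}

open Classical in
/-- BFPS's CLIQUE objective `w^G ∈ ℝ^{n×n}` for a graph `G` on the vertex set `V ⊆ [n]` (only the adjacency
of `G` inside `V` matters): `w_ii = 1` for `i ∈ V`, `w_ij = −1` for non-edges `i ≠ j` inside `V`, `0`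
otherwise («we have `w^G = I − A(Ḡ)`» when `V = [n]`). [cite: BraunEtAl2012, §4.2 (p. 13)] -/
def cliqueObjective (V : Finset (Fin n)) (G : SimpleGraph (Fin n)) : Matrix (Fin n) (Fin n) ℝ :=
  fun i j => if i = j then (if i ∈ V then 1 else 0) else (if i ∈ V ∧ j ∈ V ∧ ¬ G.Adj i j then -1 else 0)

open Classical in
/-- The clique number `ω(G[V])`: the largest size of a clique of `G` inside `V`.
[cite: BraunEtAl2012, §4.2 (p. 13, "the clique number `ω(G)`")] -/
def cliqueNumOn (V : Finset (Fin n)) (G : SimpleGraph (Fin n)) : ℕ :=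
  (V.powerset.filter (fun S : Finset (Fin n) => G.IsClique (↑S : Set (Fin n)))).sup Finset.card

/-- BFPS's outer convex set `Q^all` of the CLIQUE encoding: `⟨w^G, x⟩ ≤ ω(G)` for every graph `G` with
`V(G) ⊆ [n]`, and `x_ij ≥ 0` for `i ≠ j`. [cite: BraunEtAl2012, §4.2 (p. 14, definition of `Q^all`)] -/
def cliqueOuterAll (n : ℕ) : Set (Fin (n * n) → ℝ) :=
  {x | (∀ (V : Finset (Fin n)) (G : SimpleGraph (Fin n)), flat (cliqueObjective V G) ⬝ᵥ x ≤ cliqueNumOn V G) ∧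
    ∀ i j : Fin n, i ≠ j → 0 ≤ x (finProdFinEquiv (i, j))}

/-- For the EMPTY graph on the support of `a ∈ {0,1}ⁿ`, `w^G = 2·diag(a) − aaᵀ` (the matrix of
`corCliqueMat a`). [cite: BraunEtAl2012, §4.2 Lemma 7, proof (p. 14)] -/
theorem cliqueObjective_bot_eq_corCliqueMat (a : Cube n) :
    cliqueObjective (Finset.univ.filter fun i => a i = true) (⊥ : SimpleGraph (Fin n)) = corCliqueMat a := by
  classical
  unfold cliqueObjective corCliqueMat
  funext i j
  simp only [Finset.mem_filter, Finset.mem_univ, true_and, SimpleGraph.bot_adj, not_false_eq_true, and_true,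
    Matrix.sub_apply, Matrix.smul_apply, Matrix.diagonal_apply, Matrix.vecMulVec_apply, smul_eq_mul, bvec]
  by_cases hij : i = j
  · subst hij
    by_cases ha : a i = true <;> norm_num [ha]
  · by_cases ha : a i = true <;> by_cases hb : a j = true <;> norm_num [hij, ha, hb]

/-- `ω(G[V]) ≤ m` once every clique of `G` inside `V` has at most `m` vertices.
[cite: BraunEtAl2012, §4.2 (p. 13, "the clique number `ω(G)`")] -/
theorem cliqueNumOn_le {V : Finset (Fin n)} {G : SimpleGraph (Fin n)} {m : ℕ}
    (h : ∀ S : Finset (Fin n), S ⊆ V → G.IsClique (↑S : Set (Fin n)) → S.card ≤ m) : cliqueNumOn V G ≤ m := by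
  classical
  unfold cliqueNumOn
  refine Finset.sup_le fun S hS => ?_
  simp only [Finset.mem_filter, Finset.mem_powerset] at hS
  exact h S hS.1 hS.2

/-- The empty graph has clique number `≤ 1` on any vertex set. [cite: BraunEtAl2012, §4.2 Lemma 7, proof
("restricting to graphs `G` with `ω(G) = 1`", p. 14)] -/
theorem cliqueNumOn_bot_le_one (V : Finset (Fin n)) : cliqueNumOn V (⊥ : SimpleGraph (Fin n)) ≤ 1 := by
  refine cliqueNumOn_le fun S _ hS => ?_
  rw [Finset.card_le_one]
  intro x hx y hy
  by_contra hxy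
  exact hS hx hy hxy

/-- **BFPS Lemma 7**: `Q^all ⊆ Q(n)` (`= corOuter n 1`). [cite: BraunEtAl2012, §4.2 Lemma 7 (p. 14)] -/
theorem BFPS2012_lemma7 (n : ℕ) : cliqueOuterAll n ⊆ corOuter n 1 := by
  intro x hx a
  have h := hx.1 (Finset.univ.filter fun i => a i = true) ⊥
  rw [cliqueObjective_bot_eq_corCliqueMat] at h
  refine h.trans ?_
  exact_mod_cast cliqueNumOn_bot_le_one _

/-- ★ **BFPS Theorem 8 (polyhedral inapproximability of CLIQUE), second sentence**: for `0 < ε < 1/2`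
there are `c > 0` and `n₀` such that for `n ≥ n₀`, every `K ⊆ ℝ^{n×n}` with `COR(n) ⊆ K ⊆ n^{1/2−ε}·Q^all`
and every size-`r` extended formulation of `K` satisfy `2^{c·n^{2ε}} ≤ r` — «every `n^{1/2−ε}`-approximate
EF of CLIQUE has size `2^{Ω(n^{2ε})}`».  From Theorem 6 (`BFPS2012_corSandwichHard_holds`) with
`β = 1/2 − ε`, `ρ = n^β`, via Lemma 7. [cite: BraunEtAl2012, Thm 8 (§4.2, p. 14)] -/
theorem BFPS2012_thm8 {ε : ℝ} (hε0 : 0 < ε) (hε : ε < 1 / 2) :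
    ∃ c : ℝ, 0 < c ∧ ∃ n₀ : ℕ, ∀ n : ℕ, n₀ ≤ n → ∀ (K : Set (Fin (n * n) → ℝ)) (r : ℕ),
      corPolytope n ⊆ K → K ⊆ ((n : ℝ) ^ (1 / 2 - ε)) • cliqueOuterAll n → HasEFOfSize K r →
      (2 : ℝ) ^ (c * (n : ℝ) ^ (2 * ε)) ≤ r := by
  obtain ⟨c, hc, n₀, hn₀⟩ := BFPS2012_corSandwichHard_holds (1 / 2 - ε) (by linarith) (by linarith) 1 one_pos
  refine ⟨c, hc, max n₀ 1, fun n hn K r hP hQ hEF => ?_⟩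
  have hn1 : (1 : ℝ) ≤ n := by exact_mod_cast (le_trans (le_max_right _ _) hn)
  set ρ : ℝ := (n : ℝ) ^ (1 / 2 - ε) with hρ
  have hρ1 : 1 ≤ ρ := Real.one_le_rpow hn1 (by linarith)
  have hρ0 : 0 < ρ := by linarith
  have hKQ : K ⊆ corOuter n ρ := by
    rw [corOuter_eq_smul_corOuter_one hρ0]
    exact hQ.trans (Set.smul_set_mono (BFPS2012_lemma7 n))
  have h := hn₀ n (le_trans (le_max_left _ _) hn) ρ hρ1 (by rw [one_mul]) K r hP hKQ hEF
  rwa [show (1 : ℝ) - 2 * (1 / 2 - ε) = 2 * ε by ring] at h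

end Literature.Combinatorics.Optimization

end
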